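import Literature.Combinatorics.SimpleGraph.CycleSpaceSeparators
import HarnessLib

/-!
# Timár's lemma on minimal separators without a finiteness assumption on the vertex type

Topic `Literature/Combinatorics/SimpleGraph`. Companion of `CycleSpaceSeparators.lean`, where Timár's
lemma (Á. Timár, *Boundary-connectivity via graph theory*, Proc. AMS 141 (2013) 475–480, Lemma 1)
and its chordal corollary are proved for a FINITE vertex type: the only use of finiteness there is
the handshake step (a vertex of odd degree in a finite edge set is joined to another vertex of odd
degree), taken from Mathlib's degree-sum formula for finite graphs. Here that step is proved for an
arbitrary vertex type by induction on the finite edge set (remove an edge at the odd vertex and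
recurse from its other endpoint), and Timár's lemma with its corollary are re-derived verbatim from
it — this is the form needed on the infinite lattices `ℤ^d` and `ℤ^{d★}` (the intended use: contours
of lattice spin systems, which separate a point from the far region).

* `exists_reachable_odd_of_odd_gen` — handshake in the graph spanned by a finite loop-free edge set;
* `exists_generator_meeting_both_gen` — Timár's lemma, any vertex type;
* `minimalSeparator_adjacent_across_gen` — minimal separators are connected for a relation in which
  the generators are chordal.

Everything is proved; no named facts.

## References

* Á. Timár, *Boundary-connectivity via graph theory*, Proc. Amer. Math. Soc. 141 (2013) 475–480,
  arXiv:0711.1713: Lemma 1 and the proof of Theorem 2. [Timar2013]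
-/

open Finset SimpleGraph

namespace Literature.Combinatorics.SimpleGraph.CycleSpace

variable {α : Type*} [DecidableEq α]

/-! ### Handshake without finiteness of the vertex type -/

/-- Removing an edge lowers the degree by one at its endpoints and keeps it elsewhere. [folklore] -/
theorem edgeDeg_erase_add (Q : Finset (Sym2 α)) {e : Sym2 α} (he : e ∈ Q) (v : α) :
    edgeDeg (Q.erase e) v + (if v ∈ e then 1 else 0) = edgeDeg Q v := by
  unfold edgeDeg
  rw [Finset.filter_erase]
  split_ifs with hv
  · exact Finset.card_erase_add_one (mem_filter.2 ⟨he, hv⟩)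
  · rw [erase_eq_of_notMem (show e ∉ Q.filter (v ∈ ·) from fun h => hv (mem_filter.1 h).2), add_zero]

/-- **Handshake in a component, any vertex type**: in the graph spanned by a finite loop-free edge
set `Q`, a vertex of odd `Q`-degree is joined to another vertex of odd `Q`-degree. Proof by
induction on `#Q`: take an edge `x x₁ ∈ Q`; if `x₁` is odd we are done, else `x₁` is odd for
`Q ∖ {x x₁}` and the induction hypothesis from `x₁` yields an odd vertex, which is not `x`.
[cite: Timar2013, Lemma 1 (proof: "contains a path from x to y")] -/
theorem exists_reachable_odd_of_odd_gen (Q : Finset (Sym2 α)) (hQ : ∀ e ∈ Q, ¬e.IsDiag) {x : α}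
    (hx : Odd (edgeDeg Q x)) :
    ∃ w : α, w ≠ x ∧ (fromEdgeSet (↑Q : Set (Sym2 α))).Reachable x w ∧ Odd (edgeDeg Q w) := by
  induction hn : #Q using Nat.strong_induction_on generalizing Q x with
  | _ n ih =>
  -- an edge of `Q` at `x`
  have hpos : 0 < edgeDeg Q x := Nat.pos_of_ne_zero fun h => by rw [h] at hx; exact (Nat.not_odd_zero hx)
  obtain ⟨e, he⟩ := Finset.card_pos.1 hpos
  obtain ⟨heQ, hxe⟩ := mem_filter.1 he
  obtain ⟨x₁, rfl⟩ : ∃ x₁, e = s(x, x₁) := by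
    induction e using Sym2.ind with
    | h a b =>
      rcases Sym2.mem_iff.1 hxe with rfl | rfl
      · exact ⟨b, rfl⟩
      · exact ⟨a, Sym2.eq_swap⟩
  have hxx₁ : x ≠ x₁ := fun h => hQ _ heQ (by rw [h]; exact rfl)
  have hadj : (fromEdgeSet (↑Q : Set (Sym2 α))).Adj x x₁ := by
    rw [fromEdgeSet_adj, Finset.mem_coe]
    exact ⟨heQ, hxx₁⟩
  by_cases hodd₁ : Odd (edgeDeg Q x₁)
  · exact ⟨x₁, hxx₁.symm, hadj.reachable, hodd₁⟩
  -- recurse from `x₁` in `Q ∖ {e}`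
  set Q' := Q.erase s(x, x₁) with hQ'
  have hdeg₁ := edgeDeg_erase_add Q heQ x₁
  have hdegx := edgeDeg_erase_add Q heQ x
  rw [if_pos (Sym2.mem_mk_right x x₁)] at hdeg₁
  rw [if_pos (Sym2.mem_mk_left x x₁)] at hdegx
  have hodd₁' : Odd (edgeDeg Q' x₁) := by
    rw [Nat.not_odd_iff_even] at hodd₁
    rw [← hdeg₁] at hodd₁
    exact (Nat.even_add_one.1 hodd₁) |> Nat.not_even_iff_odd.1
  have hcard : #Q' < n := by rw [← hn]; exact card_erase_lt_of_mem heQ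
  obtain ⟨w, hwx₁, hreach, hwodd⟩ := ih _ hcard Q' (fun e he => hQ e (mem_of_mem_erase he)) hodd₁' rfl
  have hwx : w ≠ x := by
    rintro rfl
    rw [← hdegx] at hx
    exact Nat.not_even_iff_odd.2 hx (hwodd.add_odd odd_one)
  refine ⟨w, hwx, hadj.reachable.trans (hreach.mono ?_), ?_⟩
  · exact fromEdgeSet_mono (by rw [Finset.coe_subset]; exact erase_subset _ _)
  · have hdw := edgeDeg_erase_add Q heQ w
    have hwe : w ∉ s(x, x₁) := by
      rw [Sym2.mem_iff, not_or]; exact ⟨hwx, hwx₁⟩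
    rw [if_neg hwe, add_zero] at hdw
    rwa [← hdw]

/-! ### Timár's lemma, any vertex type -/

section Timar

variable {G : SimpleGraph α}

/-- **Timár's lemma** (Timár 2013, Lemma 1) for an arbitrary vertex type — statement and proof as
in `exists_generator_meeting_both`, with the handshake step `exists_reachable_odd_of_odd_gen`: if `𝒞`
generates the cycle space of `G` and `S` is a minimal set separating `x ∉ S` from a `G`-connected
vertex set `Y` disjoint from `S`, then for every partition of `S` into two non-empty parts some
generator meets both. [cite: Timar2013, Lemma 1] -/
theorem exists_generator_meeting_both_gen {𝒞 : Set (Finset (Sym2 α))} (hgen : GeneratesCycles G 𝒞)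
    (h𝒞 : ∀ C ∈ 𝒞, IsEvenEdgeSet C) (h𝒞E : ∀ C ∈ 𝒞, ∀ e ∈ C, e ∈ G.edgeSet)
    {x : α} {Y : Set α} {S : Finset α} (hxS : x ∉ S) (hYS : ∀ y ∈ Y, y ∉ S)
    (hY : ∀ y ∈ Y, ∀ y' ∈ Y, ∃ p : G.Walk y y', ∀ w ∈ p.support, w ∈ Y)
    (hsep : ∀ y ∈ Y, ∀ p : G.Walk x y, ∃ s ∈ S, s ∈ p.support)
    (hmin : ∀ s ∈ S, ∃ y ∈ Y, ∃ p : G.Walk x y, ∀ w ∈ p.support, w ∈ S → w = s)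
    {S₁ S₂ : Finset α} (hS : ∀ s, s ∈ S ↔ s ∈ S₁ ∨ s ∈ S₂) (h₁ : S₁.Nonempty) (h₂ : S₂.Nonempty)
    (h₁₂ : Disjoint S₁ S₂) :
    ∃ C ∈ 𝒞, (∃ e ∈ C, ∃ s ∈ S₁, s ∈ e) ∧ (∃ e ∈ C, ∃ s ∈ S₂, s ∈ e) := by
  classical
  by_contra hcon
  push Not at hcon
  -- paths avoiding `S₂`, resp. `S₁`
  obtain ⟨s₁, hs₁⟩ := h₁
  obtain ⟨s₂, hs₂⟩ := h₂
  obtain ⟨y₁, hy₁, p₁, hp₁⟩ := hmin s₁ ((hS s₁).2 (Or.inl hs₁))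
  obtain ⟨y₂, hy₂, p₂, hp₂⟩ := hmin s₂ ((hS s₂).2 (Or.inr hs₂))
  obtain ⟨r, hr⟩ := hY y₂ hy₂ y₁ hy₁
  -- both walks end at `y₁`
  set q₁ : G.Walk x y₁ := p₁.bypass with hq₁
  set q₂ : G.Walk x y₁ := (p₂.append r).bypass with hq₂
  have hq₁S₂ : ∀ w ∈ q₁.support, w ∉ S₂ := by
    intro w hw hw₂
    have hwS : w ∈ S := (hS w).2 (Or.inr hw₂)
    have := hp₁ w (p₁.support_bypass_subset_support hw) hwS
    subst this
    exact Finset.disjoint_left.1 h₁₂ hs₁ hw₂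
  have hq₂S₁ : ∀ w ∈ q₂.support, w ∉ S₁ := by
    intro w hw hw₁
    have hwS : w ∈ S := (hS w).2 (Or.inl hw₁)
    have hw' := (p₂.append r).support_bypass_subset_support hw
    rw [Walk.mem_support_append_iff] at hw'
    rcases hw' with hw' | hw'
    · have := hp₂ w hw' hwS
      subst this
      exact Finset.disjoint_left.1 h₁₂ hw₁ hs₂
    · exact hYS w (hr w hw') hwS
  have hxy : x ≠ y₁ := by
    rintro rfl
    obtain ⟨s, hs, hsx⟩ := hsep x hy₁ Walk.nil
    rw [Walk.support_nil, List.mem_singleton] at hsx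
    exact hxS (hsx ▸ hs)
  set E₁ := walkEdges q₁ with hE₁
  set E₂ := walkEdges q₂ with hE₂
  -- `E₁ ∆ E₂` is even, made of edges of `G`, hence in the span
  have hpath₁ : q₁.IsPath := p₁.bypass_isPath
  have hpath₂ : q₂.IsPath := (p₂.append r).bypass_isPath
  have hZeven : IsEvenEdgeSet (symmDiff E₁ E₂) := by
    intro w
    rw [even_edgeDeg_symmDiff_iff, ← not_iff_not, Nat.not_even_iff_odd, Nat.not_even_iff_odd,
      odd_edgeDeg_walkEdges_iff hpath₁ hxy, odd_edgeDeg_walkEdges_iff hpath₂ hxy]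
  have hZedges : ∀ e ∈ symmDiff E₁ E₂, e ∈ G.edgeSet := by
    intro e he
    rw [mem_symmDiff] at he
    rcases he with ⟨h, -⟩ | ⟨h, -⟩
    · exact mem_edgeSet_of_mem_walkEdges q₁ h
    · exact mem_edgeSet_of_mem_walkEdges q₂ h
  have hZ : InSpan 𝒞 (symmDiff E₁ E₂) := hgen _ hZedges hZeven
  -- split along "meets `S₁`"
  obtain ⟨Z₁, Z₂, hZ₁, hZ₂, hZeq⟩ := hZ.split (fun C => ∃ e ∈ C, ∃ s ∈ S₁, s ∈ e)
  -- the generators in `Z₁` avoid `S₂`, those in `Z₂` avoid `S₁`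
  have hZ₁S₂ : ∀ e ∈ Z₁, ∀ s ∈ S₂, s ∉ e := by
    intro e he s hs hse
    obtain ⟨C, ⟨hC, hP⟩, heC⟩ := hZ₁.exists_mem he
    exact hcon C hC hP e heC s hs hse
  have hZ₂S₁ : ∀ e ∈ Z₂, ∀ s ∈ S₁, s ∉ e := by
    intro e he s hs hse
    obtain ⟨C, ⟨_, hP⟩, heC⟩ := hZ₂.exists_mem he
    exact hP ⟨e, heC, s, hs, hse⟩
  -- `Q := E₁ ∆ Z₁ = E₂ ∆ Z₂`
  set Q := symmDiff E₁ Z₁ with hQdef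
  have hQ' : Q = symmDiff E₂ Z₂ := by
    rw [hQdef, ← symmDiff_symmDiff_cancel_right Z₂ Z₁, ← hZeq, ← symmDiff_assoc,
      symmDiff_symmDiff_cancel_left]
  -- `Q` avoids `S`
  have hQS : ∀ e ∈ Q, ∀ s ∈ S, s ∉ e := by
    intro e he s hs hse
    rcases (hS s).1 hs with hs₁ | hs₂
    · rw [hQ', mem_symmDiff] at he
      rcases he with ⟨h, -⟩ | ⟨h, -⟩
      · exact hq₂S₁ s (mem_support_of_mem_walkEdges q₂ h hse) hs₁
      · exact hZ₂S₁ e h s hs₁ hse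
    · rw [hQdef, mem_symmDiff] at he
      rcases he with ⟨h, -⟩ | ⟨h, -⟩
      · exact hq₁S₂ s (mem_support_of_mem_walkEdges q₁ h hse) hs₂
      · exact hZ₁S₂ e h s hs₂ hse
  -- `Q` is loop-free and has odd degree exactly at `x` and `y₁`
  have h𝒞₁ : ∀ C ∈ {C | C ∈ 𝒞 ∧ ∃ e ∈ C, ∃ s ∈ S₁, s ∈ e}, IsEvenEdgeSet C := fun C hC => h𝒞 C hC.1
  have hZ₁even : IsEvenEdgeSet Z₁ := hZ₁.isEvenEdgeSet h𝒞₁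
  have hQodd : ∀ w, Odd (edgeDeg Q w) ↔ w = x ∨ w = y₁ := by
    intro w
    rw [← odd_edgeDeg_walkEdges_iff hpath₁ hxy w, ← Nat.not_even_iff_odd, ← Nat.not_even_iff_odd,
      hQdef, even_edgeDeg_symmDiff_iff]
    have := hZ₁even w
    tauto
  have hZ₁E : ∀ e ∈ Z₁, e ∈ G.edgeSet := fun e he => by
    obtain ⟨C, ⟨hC, -⟩, heC⟩ := hZ₁.exists_mem he
    exact h𝒞E C hC e heC
  have hQedges : ∀ e ∈ Q, e ∈ G.edgeSet := by
    intro e he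
    rw [hQdef, mem_symmDiff] at he
    rcases he with ⟨h, -⟩ | ⟨h, -⟩
    · exact mem_edgeSet_of_mem_walkEdges q₁ h
    · exact hZ₁E e h
  have hQdiag : ∀ e ∈ Q, ¬e.IsDiag := fun e he => G.not_isDiag_of_mem_edgeSet (hQedges e he)
  -- handshake: `x` is joined in `Q` to the other odd vertex, `y₁`
  obtain ⟨w, hwx, hreach, hwodd⟩ := exists_reachable_odd_of_odd_gen Q hQdiag ((hQodd x).2 (Or.inl rfl))
  have hw : w = y₁ := ((hQodd w).1 hwodd).resolve_left hwx
  subst hw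
  obtain ⟨walk⟩ := hreach
  have hwalkS : ∀ v ∈ walk.support, v ∉ S := by
    intro v hv hvS
    rcases support_subset_of_walk_fromEdgeSet walk v hv with rfl | ⟨e, he, hve⟩
    · exact hxS hvS
    · exact hQS e he v hvS hve
  -- transfer the walk to `G`: it joins `x` to `Y` avoiding `S`
  have hedges : ∀ e ∈ walk.edges, e ∈ G.edgeSet := by
    intro e he
    have h := walk.edges_subset_edgeSet he
    rw [edgeSet_fromEdgeSet] at h
    exact hQedges e h.1
  obtain ⟨s, hs, hsupp⟩ := hsep _ hy₁ (walk.transfer G hedges)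
  rw [Walk.support_transfer] at hsupp
  exact hwalkS s hsupp hs

/-- **Minimal cutsets are connected in a supergraph in which the generators are chordal**, any
vertex type (Timár 2013, proof of Thm. 2): under the hypotheses of
`exists_generator_meeting_both_gen`, if any two distinct vertices on edges of a generator are
`adj⁺`-related, then across every 2-partition of `S` there are `s₁ ∈ S₁`, `s₂ ∈ S₂` with
`adj⁺ s₁ s₂`. [cite: Timar2013, Thm. 2 (proof)] -/
theorem minimalSeparator_adjacent_across_gen {𝒞 : Set (Finset (Sym2 α))} (hgen : GeneratesCycles G 𝒞)
    (h𝒞 : ∀ C ∈ 𝒞, IsEvenEdgeSet C) (h𝒞E : ∀ C ∈ 𝒞, ∀ e ∈ C, e ∈ G.edgeSet)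
    {adjPlus : α → α → Prop}
    (hchordal : ∀ C ∈ 𝒞, ∀ e ∈ C, ∀ e' ∈ C, ∀ a ∈ e, ∀ b ∈ e', a ≠ b → adjPlus a b)
    {x : α} {Y : Set α} {S : Finset α} (hxS : x ∉ S) (hYS : ∀ y ∈ Y, y ∉ S)
    (hY : ∀ y ∈ Y, ∀ y' ∈ Y, ∃ p : G.Walk y y', ∀ w ∈ p.support, w ∈ Y)
    (hsep : ∀ y ∈ Y, ∀ p : G.Walk x y, ∃ s ∈ S, s ∈ p.support)
    (hmin : ∀ s ∈ S, ∃ y ∈ Y, ∃ p : G.Walk x y, ∀ w ∈ p.support, w ∈ S → w = s)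
    {S₁ S₂ : Finset α} (hS : ∀ s, s ∈ S ↔ s ∈ S₁ ∨ s ∈ S₂) (h₁ : S₁.Nonempty) (h₂ : S₂.Nonempty)
    (h₁₂ : Disjoint S₁ S₂) :
    ∃ s₁ ∈ S₁, ∃ s₂ ∈ S₂, adjPlus s₁ s₂ := by
  obtain ⟨C, hC, ⟨e, he, s₁, hs₁, hse⟩, ⟨e', he', s₂, hs₂, hse'⟩⟩ :=
    exists_generator_meeting_both_gen hgen h𝒞 h𝒞E hxS hYS hY hsep hmin hS h₁ h₂ h₁₂
  exact ⟨s₁, hs₁, s₂, hs₂, hchordal C hC e he e' he' s₁ hse s₂ hse'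
    (fun h => Finset.disjoint_left.1 h₁₂ hs₁ (h ▸ hs₂))⟩

end Timar

end Literature.Combinatorics.SimpleGraph.CycleSpace
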